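import Summits.Ventures.HSemireg.WedgeBoxHighCount

/-!
# Venture HSemireg — THEOREM K∘T for the box (8/8)

HONEST FRAMING. Part of the Lean index of the computation cell `pub-hsemireg` (seat p3; Sunday enclosure of the
FORMULA-N kernel assets of seats th-7 / th-6, ENCLOSURE-PLAN-p3.md).  Finite-dimensional exterior algebra over a field ONLY:
no variety, no cohomology theory, no semiregularity map is constructed here; nothing here says that HC / HC_CM / HC_AV holds;
no Literature fact is declared or used.  The geometric DICTIONARY (why these ranks are the `HT`-side box ranks of the cell's
STRUCTURE.md §1 / theory/FORMULA-N.md) lives in theory/FORMULA-N-th7.md PART B §A.3 / §N and is NOT asserted in Lean.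

THEOREM K∘T for the BOX of two point pairs (FORMULA-N PART A §2.3 / PART B §L; th-7 theory/th7/BoxRank.lean v4 sha256/16
88aeb4a1de514ae6, l.1727–1922), file 8 of 8 — generators `I n := Fin (4n)` in four blocks `A 0 = X`, `A 1 = Y` (factor 1), `C 0 = X′`,
`C 1 = Y′` (factor 2); the coefficient-matrix box `boxClass c := Σ_{α,β} c α β • E_{A α ∪ C β}` and the HONEST box `fac1 a * fac2 a′`;
ranks of `θ ↦ θ ∧ box` on `⋀^k` in every degree: `4C(2n,k) − 4C(n,k)` (0 < k < n), the degree-n PURITY DROP `4C(2n,n) − 6` on the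
decomposable locus, `4C(2n,k) − 4C(n,k−n)` (n < k < 2n), `1` in degrees 0 and 2n; one citable form `finrank_range_wedgeMap_fac_mul_all`
(file 8).  No permutation sign is ever evaluated.  th-7's statements and proofs, unchanged (namespace `HSemiregBox` ↦
`Summit.Ventures.HSemireg.WedgeBox`; this family's Fin-indexed `B K n s` is its own, kept apart from `Wedge.B` / `WedgePair.B` by namespace).
Part IV: degrees 0 and 2n, and **`finrank_range_wedgeMap_fac_mul_all`** — `R_k(n)` for ALL `0 ≤ k ≤ 2n` in one additive ℕ statement.
-/

open Module Set Set.powersetCard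

namespace Summit.Ventures.HSemireg.WedgeBox

variable (K : Type*) [Field K] {n : ℕ}

section AllDegrees

variable {k : ℕ}

/-- `P α β` determines `(α, β)` (`n > 0`). -/
lemma P_injective (hn : 0 < n) {α β γ δ : Fin 2} (h : P n α β = P n γ δ) : α = γ ∧ β = δ := by
  obtain ⟨i, hi⟩ : (A n α).Nonempty := by rw [← Finset.card_pos, card_A]; exact hn
  obtain ⟨j, hj⟩ : (C n β).Nonempty := by rw [← Finset.card_pos, card_C]; exact hn
  have hi' : i ∈ P n γ δ := by rw [← h]; exact Finset.mem_union_left _ hi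
  have hj' : j ∈ P n γ δ := by rw [← h]; exact Finset.mem_union_right _ hj
  exact ⟨(eq_of_mem_A_of_mem_P hi hi').symm, (eq_of_mem_C_of_mem_P hj hj').symm⟩

/-- coordinates of the box class at the four (distinct) `P γ δ`. -/
lemma coord_boxClass (hn : 0 < n) (c : Fin 2 → Fin 2 → K) (γ δ : Fin 2) :
    (B K n).coord (P n γ δ) (boxClass K n c) = c γ δ := by
  classical
  rw [boxClass]
  simp only [map_sum, map_smul, coe_Ppc, Basis.coord_apply, Basis.repr_self, smul_eq_mul,
    Finsupp.single_apply]
  have hite : ∀ α β, (if P n α β = P n γ δ then (1 : K) else 0) = if α = γ ∧ β = δ then 1 else 0 := by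
    intro α β
    by_cases h : α = γ ∧ β = δ
    · rw [if_pos h, if_pos (by rw [h.1, h.2])]
    · rw [if_neg h, if_neg (fun e => h (P_injective hn e))]
  simp_rw [hite]
  rw [Finset.sum_eq_single γ (fun α _ hα => by simp [hα]) (by simp),
    Finset.sum_eq_single δ (fun β _ hβ => by simp [hβ]) (by simp)]
  simp

/-- the box class is non-zero when `c 0 0 ≠ 0` (`n > 0`). -/
lemma boxClass_ne_zero (hn : 0 < n) {c : Fin 2 → Fin 2 → K} (hc : c 0 0 ≠ 0) : boxClass K n c ≠ 0 := by
  intro h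
  have := coord_boxClass K hn c 0 0
  rw [h, map_zero] at this
  exact hc this.symm

/-- the empty monomial is `1`. -/
lemma B_empty : (B K n) (∅ : Finset (I n)) = 1 := by
  change (b K n).ExteriorAlgebra ∅ = 1
  rw [ExteriorAlgebra.basis_apply_ofCard (b K n) (s := ∅) Finset.card_empty]
  show ExteriorAlgebra.ιMulti K 0 _ = 1
  rw [ExteriorAlgebra.ιMulti_apply]
  simp

/-- degree `0`: the range is the line spanned by `v`. -/
theorem finrank_range_wedgeMap_boxClass_zero (hn : 0 < n) {c : Fin 2 → Fin 2 → K} (hc : c 0 0 ≠ 0) :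
    Module.finrank K (LinearMap.range (wedgeMap K n 0 (boxClass K n c))) = 1 := by
  have hr : LinearMap.range (wedgeMap K n 0 (boxClass K n c)) = K ∙ boxClass K n c := by
    rw [range_wedgeMap]
    congr 1
    ext y
    simp only [Set.mem_range, Set.mem_singleton_iff]
    constructor
    · rintro ⟨s, rfl⟩
      have hs : (s : Finset (I n)) = ∅ := Finset.card_eq_zero.mp (card_eq s)
      rw [B_apply_pc, hs]
      change (B K n) ∅ * boxClass K n c = boxClass K n c
      rw [B_empty, one_mul]
    · rintro rfl
      refine ⟨⟨∅, by rw [mem_iff, Finset.card_empty]⟩, ?_⟩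
      change (B K n) ∅ * boxClass K n c = boxClass K n c
      rw [B_empty, one_mul]
  rw [hr, finrank_span_singleton (boxClass_ne_zero K hn hc)]

/-- degree `2n`: every relevant monomial is a whole `P γ δ` and maps to a multiple of the top monomial. -/
theorem finrank_range_wedgeMap_boxClass_top (hn : 0 < n) {c : Fin 2 → Fin 2 → K} (hc : ∀ α β, c α β ≠ 0) :
    Module.finrank K (LinearMap.range (wedgeMap K n (n + n) (boxClass K n c))) = 1 := by
  classical
  -- every relevant monomial of degree 2n is some P γ δ
  have hRel : ∀ s ∈ Rel n (n + n), ∃ γ δ, s = P n γ δ := by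
    intro s hs
    obtain ⟨⟨γ, δ⟩, hsMix⟩ := mem_Mix_of_Rel_high (k := n + n) (by omega) hs
    obtain ⟨hsub, hcard, -, -⟩ := mem_Mix.mp hsMix
    exact ⟨γ, δ, Finset.eq_of_subset_of_card_le hsub (by rw [card_P, hcard])⟩
  -- the image of P γ δ is a non-zero multiple of the monomial on P γ δ ∪ P γ̄ δ̄
  have hinner : ∀ γ δ α : Fin 2,
      (∑ β, (c α β * sgn K (Ppc n γ δ) (Ppc n α β)) • (B K n) ((Ppc n γ δ).val ∪ P n α β)) =
        (c α (other δ) * sgn K (Ppc n γ δ) (Ppc n α (other δ))) •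
          (B K n) ((Ppc n γ δ).val ∪ P n α (other δ)) := by
    intro γ δ α
    apply Finset.sum_eq_single_of_mem _ (Finset.mem_univ _)
    intro β _ hβ
    have hβ' : β = δ := by
      by_contra h; exact hβ (eq_other_of_ne h)
    subst hβ'
    obtain ⟨j, hj⟩ : (C n β).Nonempty := by rw [← Finset.card_pos, card_C]; exact hn
    rw [sgn_of_not_disjoint K (fun hd => Finset.disjoint_left.mp hd
      (Finset.mem_union_right _ hj) (Finset.mem_union_right _ hj)), mul_zero, zero_smul]
  have htop : ∀ γ δ : Fin 2,
      B K n (Ppc n γ δ) * boxClass K n c =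
        (c (other γ) (other δ) * sgn K (Ppc n γ δ) (Ppc n (other γ) (other δ))) •
          (B K n) (P n γ δ ∪ P n (other γ) (other δ)) := by
    intro γ δ
    rw [B_mul_boxClass]
    simp_rw [hinner γ δ]
    rw [Finset.sum_eq_single_of_mem (other γ) (Finset.mem_univ _)]
    · rfl
    · intro α _ hα
      have hα' : α = γ := by
        by_contra h; exact hα (eq_other_of_ne h)
      subst hα'
      obtain ⟨i, hi⟩ : (A n α).Nonempty := by rw [← Finset.card_pos, card_A]; exact hn
      rw [sgn_of_not_disjoint K (fun hd => Finset.disjoint_left.mp hd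
        (Finset.mem_union_left _ hi) (Finset.mem_union_left _ hi)), mul_zero, zero_smul]
  have hcoef : ∀ γ δ : Fin 2, c (other γ) (other δ) * sgn K (Ppc n γ δ) (Ppc n (other γ) (other δ)) ≠ 0 := by
    intro γ δ
    refine mul_ne_zero (hc _ _) ((sgn_ne_zero_iff K).mpr ?_)
    change Disjoint (P n γ δ) (P n (other γ) (other δ))
    rw [disjoint_P_iff]
    exact ⟨disjoint_A_of_subset_P subset_rfl, disjoint_C_of_subset_P subset_rfl⟩
  -- all these tops are the same set: univ
  have huniv : ∀ γ δ : Fin 2, P n γ δ ∪ P n (other γ) (other δ) = Finset.univ := by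
    intro γ δ
    ext i
    simp only [Finset.mem_union, Finset.mem_univ, iff_true, P]
    rcases mem_cover n i with ⟨α, h⟩ | ⟨β, h⟩
    · by_cases hα : α = γ
      · subst hα; exact Or.inl (Or.inl h)
      · rw [eq_other_of_ne hα] at h; exact Or.inr (Or.inl h)
    · by_cases hβ : β = δ
      · subst hβ; exact Or.inl (Or.inr h)
      · rw [eq_other_of_ne hβ] at h; exact Or.inr (Or.inr h)
  have hr : LinearMap.range (wedgeMap K n (n + n) (boxClass K n c)) =
      K ∙ (B K n) (Finset.univ : Finset (I n)) := by
    rw [range_eq_span_vec]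
    apply le_antisymm
    · rw [Submodule.span_le]
      rintro _ ⟨s, rfl⟩
      obtain ⟨γ, δ, hs⟩ := hRel s.1 s.2
      have hB : B K n (relPc s) = B K n (Ppc n γ δ) := by
        rw [B_apply_pc, B_apply_pc, coe_relPc, hs]; rfl
      rw [SetLike.mem_coe, vec, hB, htop, huniv]
      exact Submodule.smul_mem _ _ (Submodule.mem_span_singleton_self _)
    · rw [Submodule.span_singleton_le_iff_mem]
      have hd : Disjoint (P n 0 0) (P n 1 1) := by
        rw [disjoint_P_iff]
        exact ⟨disjoint_A_of_subset_P (α := 0) (β := 0) subset_rfl,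
          disjoint_C_of_subset_P (α := 0) (β := 0) subset_rfl⟩
      have hmem : P n 0 0 ∈ Rel n (n + n) := mem_Rel_of_disjoint (card_P n 0 0) hd
      have h1 : vec K c ⟨P n 0 0, hmem⟩ ∈ Submodule.span K (Set.range (vec K (n := n) (k := n + n) c)) :=
        Submodule.subset_span ⟨_, rfl⟩
      have hB : B K n (relPc ⟨P n 0 0, hmem⟩) = B K n (Ppc n 0 0) := by
        rw [B_apply_pc, B_apply_pc]; rfl
      rw [vec, hB, htop, huniv] at h1
      have h2 := Submodule.smul_mem _ (c (other 0) (other 0) * sgn K (Ppc n 0 0) (Ppc n (other 0) (other 0)))⁻¹ h1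
      rwa [smul_smul, inv_mul_cancel₀ (hcoef 0 0), one_smul] at h2
  rw [hr, finrank_span_singleton ((B K n).ne_zero _)]

/-- **THEOREM K∘T for the honest box, ALL degrees `0 ≤ k ≤ 2n` in ONE statement** (wedge model, every
`n ≥ 1`). With `R_k(n) = 4·C(2n,k) − 4·C(n,k) − 4·C(n,k−n) + [k=0] + 2[k=n] + [k=2n]` (FORMULA-N PART A §2.3,
convention `C(n, negative) = 0`), the rank of `θ ↦ θ ∧ (f₁ ∧ f₂)` on `⋀^k(K^{4n})` is `R_k(n) = [t^k]P_n(t)²`;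
stated additively over `ℕ`. -/
theorem finrank_range_wedgeMap_fac_mul_all (hn : 0 < n) (hk : k ≤ n + n) {a a' : Fin 2 → K}
    (ha : ∀ α, a α ≠ 0) (ha' : ∀ β, a' β ≠ 0) :
    Module.finrank K (LinearMap.range (wedgeMap K n k (fac1 K n a * fac2 K n a')))
        + 4 * n.choose k + 4 * (if n ≤ k then n.choose (k - n) else 0) =
      4 * (n + n).choose k + (if k = 0 then 1 else 0) + (if k = n then 2 else 0)
        + (if k = n + n then 1 else 0) := by
  have hcne := boxCoeff_ne_zero K (n := n) ha ha'
  rcases Nat.lt_or_ge k n with hkn | hkn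
  · -- k < n
    have e1 : (if n ≤ k then n.choose (k - n) else 0) = 0 := if_neg (by omega)
    have e2 : (if k = n then 2 else 0) = 0 := if_neg (by omega)
    have e3 : (if k = n + n then 1 else 0) = 0 := if_neg (by omega)
    rw [e1, e2, e3]
    rcases Nat.eq_zero_or_pos k with hk0 | hk0
    · subst hk0
      rw [if_pos rfl, fac1_mul_fac2, finrank_range_wedgeMap_boxClass_zero K hn (hcne 0 0)]
      simp
    · have e4 : (if k = 0 then 1 else 0) = 0 := if_neg (by omega)
      rw [e4]
      have := finrank_range_wedgeMap_fac_mul K hk0 hkn ha ha'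
      omega
  · have e1 : (if n ≤ k then n.choose (k - n) else 0) = n.choose (k - n) := if_pos hkn
    have e4 : (if k = 0 then 1 else 0) = 0 := if_neg (by omega)
    rw [e1, e4]
    rcases Nat.lt_or_ge n k with hnk | hnk
    · -- n < k
      have e2 : (if k = n then 2 else 0) = 0 := if_neg (by omega)
      rw [e2, Nat.choose_eq_zero_of_lt hnk]
      rcases Nat.lt_or_ge k (n + n) with hk2 | hk2
      · have e3 : (if k = n + n then 1 else 0) = 0 := if_neg (by omega)
        rw [e3]
        have := finrank_range_wedgeMap_fac_mul_high K hn hnk hk2 ha ha'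
        omega
      · have hk' : k = n + n := by omega
        subst hk'
        rw [if_pos rfl, fac1_mul_fac2, finrank_range_wedgeMap_boxClass_top K hn hcne,
          Nat.add_sub_cancel_left, Nat.choose_self, Nat.choose_self]
    · -- k = n
      have hk' : k = n := by omega
      subst hk'
      have e3 : (if k = k + k then 1 else 0) = 0 := if_neg (by omega)
      rw [e3, if_pos rfl, Nat.sub_self, Nat.choose_zero_right, Nat.choose_self]
      have := finrank_range_wedgeMap_fac_mul_degree_n K hn ha ha'
      omega

end AllDegrees

end Summit.Ventures.HSemireg.WedgeBox
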